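import Mathlib
import Summits.ValiantsHypothesis.ValiantsHypothesis.Theses.FreeSubtorus
import Summits.ValiantsHypothesis.ValiantsHypothesis.Cruxes.OrbitDimensionBound.Lines.DegreeLadder
import Summits.ValiantsHypothesis.ValiantsHypothesis.Theorems.FreeSubtorusConfusionCoveringGenericElement
import Literature.Computability.AlgebraicComplexity.LandsbergRessayreNormalForm
import Summits.ValiantsHypothesis.ValiantsHypothesis.Theorems.FreeSubtorusOrbitDimensionBoundStubGradedLift
import Summits.ValiantsHypothesis.ValiantsHypothesis.Theorems.FreeSubtorusOrbitDimensionBoundStubWindowCount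
import Summits.ValiantsHypothesis.ValiantsHypothesis.Theorems.FreeSubtorusOrbitDimensionBoundStubWindowWeights

/-!
# Line `quadratic_covering` — skeleton for the rung `Degree.QuadraticShadow` (entry-degree dial, window covering)

Crux advanced: `OrbitDimensionBound` (stmt-ValiantsHypothesis-16133) of `route-ValiantsHypothesis-FreeSubtorus`; floor
`SubtorusCovering` (PROVED, `subtorusCovering_proof`); rung `Degree.QuadraticShadow` / numeric `Degree.QuadraticCovering
= DegreeCovering 2` (`Lines/DegreeLadder.lean`, sorry-free: `δ = 1` IS the floor by `Iff.rfl`, `S → DegreeShadow δ` for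
every `δ`).

THE LINE (three registered stubs, composition kernel-checked; it proves the WHOLE dial `∀ δ, DegreeCovering δ`):
1. `stub_gradedLift` (M) — exact lifts of a diagonal torus element act MONOMIAL-WISE.  For a `T_Λ`-equivariant degree-`δ`
   representation `B = Σ_u B_u x^u` of `per_n` and `(d, e)` satisfying the relations of `Λ`, the exact lift `(g, h)` of
   `x_{kl} ↦ d_k e_l x_{kl}` satisfies `g · B_u = (de)^u · B_u · h` for EVERY exponent `u` (coefficient of `x^u` in
   `B(γ·x) = g B h⁻¹`; the diagonal substitution scales `x^u` by `(de)^u`), `rank B_0 = m - 1` (von zur Gathen, tree theorem,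
   valid for entries of any degree) and the kernel line of `B_0` carries an eigenvalue `γ₀ ≠ 0` of `h`.
2. `stub_windowWeights` (L, load-bearing) — LONG-EDGE GRADED LEIBNIZ / FLOW.  With weights `c` admitting no non-negative
   multiplicative relation, the monomial-wise intertwining and regularity force: for every permutation `σ` and every window
   `[a, a+δ)` of `δ` consecutive levels (`1 ≤ a`, `a + δ ≤ n`) some `I ⊆ [n]` with `a ≤ |I| < a + δ` has
   `γ₀ · ∏_{k∈I} c_{kσ(k)}` an eigenvalue of `g`.  Proof plan = the tree's affine engine
   (`Theorems/FreeSubtorusConfusionCoveringPathWeights.lean`, `stub_pathWeights`) with ONE new input: the degree-`δ` Leibniz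
   extraction — a nonzero coefficient of `∏_k x_{kσ(k)}` in `det B` yields a permutation `π ∈ S_m` and a partition of the `n`
   cells of `σ` into blocks of size `≤ δ`, block `b` read off the monomial `x^{b}` of the entry `B[i_b, π i_b]`, constants on
   the other diagonal cells of `π`; blocks are the edges of the flow (`exists_chain_of_flow` is generic in the edge type), the
   chain from `γ₀` through all blocks has prefix sizes increasing by `≤ δ`, hence meets every window.  At `δ = 1` this is
   `stub_pathWeights` (levels `1 … n-1`).
3. `stub_windowCount` (M) — WINDOW PIGEONHOLE.  If every `σ` is served by a pair `(I, σI)` with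
   `⌊n/2⌋+1-δ ≤ |I| ≤ ⌊n/2⌋` whose weight `γ₀ d^I e^{σI}` is an eigenvalue of the `m × m` matrix `g`, and characters of
   `(d, e)` separate exactly modulo the saturation of `ℤΛ` (row sums of `Λ` zero), then `C(n, ⌊n/2⌋+1-δ) ≤ m · 2^r`:
   equal weights ⇒ same level (row sums) and same Odlyzko class (`≤ 2^r` members, tree `card_confusedClass_le_two_pow`);
   `n! ≤ #pairs · s_min!(n-s_min)!` since `s ↦ s!(n-s)!` decreases on `[0, ⌊n/2⌋]`.  At `δ = 1` this is `stub_classCount`.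
Composition `degreeCovering_of`: `δ = 0` vacuous (`degreeCovering_zero`), `δ > ⌊n/2⌋` trivial (`degreeCovering_of_lt`),
else generic element (`stub_genericElement`, PROVED in the tree, degree-free) → stub 1 → stub 2 at the window
`a = ⌊n/2⌋+1-δ` → stub 3.  Then `QuadraticShadow_of` via the ladder's `degreeShadow_of_degreeCovering`.

Disproof used: `Cruxes/OrbitDimensionBound/Disproof.lean` concerns the symmetrisation crux itself (targets on
`OrbitDimensionBound`'s `∃ B`); the line proves a lower bound for GIVEN equivariant data and instantiates none of its
refuted strengthenings (it never claims a representation can be symmetrised).  Negatives index: no refuted statement of the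
summit concerns degree-`δ` representations (checked `ledger negatives --problem ValiantsHypothesis`).
-/

open Matrix MvPolynomial Finset
open Literature.Computability.AlgebraicComplexity
open Summit.ValiantsHypothesis.ValiantsHypothesis.Cruxes.OrbitDimensionBound.Degree

-- the mandated summit-side namespace repeats a component by design (single-problem summit)
set_option linter.dupNamespace false

noncomputable section

namespace Summit.ValiantsHypothesis.ValiantsHypothesis.Cruxes.OrbitDimensionBound.Degree.Line

/-! ## §1 Statements of the stubs -/

/-- Statement of stub 1 (`stub_gradedLift`, M): exact lifts of a diagonal torus element act monomial-wise; regularity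
(von zur Gathen) and the kernel-line eigenvalue.  Degree-`δ` replacement of the affine coefficient calculus
`coeffMat_linSubstEntries` + `liftOfMatrices` + `exists_eigenvalue_of_finrank_ker_eq_one`.
[cite: LandsbergRessayre2017, §6] [cite: Vonzurgathen1987, Thm. 3.1] -/
def Stmt.stub_gradedLift : Prop :=
  ∀ (δ n : ℕ), 3 ≤ n → ∀ (m r : ℕ) (Λ : Fin r → (Fin n ⊕ Fin n) → ℤ)
    (B : Matrix (Fin m) (Fin m) (MvPolynomial (Fin n × Fin n) ℂ)),
    IsDegEquivariantDetRepr δ (Subgroup.closure (torusGen n r Λ)) (perPoly (Fin n) ℂ) B →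
    ∀ d e : Fin n → ℂˣ, (∀ i, (∏ k, (d k) ^ (Λ i (Sum.inl k))) * (∏ l, (e l) ^ (Λ i (Sum.inr l))) = 1) →
    ∃ (g h : GL (Fin m) ℂ) (γ₀ : ℂ), γ₀ ≠ 0 ∧
      (∀ u : (Fin n × Fin n) →₀ ℕ,
        (g : Matrix (Fin m) (Fin m) ℂ) * B.map (MvPolynomial.coeff u) =
          (∏ p, ((d p.1 : ℂ) * (e p.2 : ℂ)) ^ (u p)) •
            (B.map (MvPolynomial.coeff u) * (h : Matrix (Fin m) (Fin m) ℂ))) ∧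
      LinearMap.ker (Matrix.toLin' (constPart B)) ≤
        Module.End.maxGenEigenspace (Matrix.toLin' (h : Matrix (Fin m) (Fin m) ℂ)) γ₀ ∧
      (constPart B).rank = m - 1

/-- Statement of stub 2 (`stub_windowWeights`, L — load-bearing): long-edge graded Leibniz / flow.  Every permutation
is served in every window of `δ` consecutive levels.  At `δ = 1` this is the tree's `stub_pathWeights`.
[cite: LandsbergRessayre2017, Thm. 2.8, §6] -/
def Stmt.stub_windowWeights : Prop :=
  ∀ (δ n m : ℕ) (B : Matrix (Fin m) (Fin m) (MvPolynomial (Fin n × Fin n) ℂ))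
    (c : Fin n × Fin n → ℂ) (g h : GL (Fin m) ℂ) (γ₀ : ℂ),
    1 ≤ δ → (∀ i j, (B i j).totalDegree ≤ δ) → B.det = perPoly (Fin n) ℂ → (constPart B).rank = m - 1 →
    (∀ p, c p ≠ 0) →
    (∀ u : Fin n × Fin n → ℕ, u ≠ 0 → (∏ p, (c p) ^ (u p)) ≠ 1) →
    (∀ u : (Fin n × Fin n) →₀ ℕ,
      (g : Matrix (Fin m) (Fin m) ℂ) * B.map (MvPolynomial.coeff u) =
        (∏ p, (c p) ^ (u p)) • (B.map (MvPolynomial.coeff u) * (h : Matrix (Fin m) (Fin m) ℂ))) →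
    LinearMap.ker (Matrix.toLin' (constPart B)) ≤
      Module.End.maxGenEigenspace (Matrix.toLin' (h : Matrix (Fin m) (Fin m) ℂ)) γ₀ →
    ∀ (σ : Equiv.Perm (Fin n)) (a : ℕ), 1 ≤ a → a + δ ≤ n →
      ∃ I : Finset (Fin n), a ≤ I.card ∧ I.card < a + δ ∧
        Module.End.maxGenEigenspace (Matrix.toLin' (g : Matrix (Fin m) (Fin m) ℂ)) (γ₀ * ∏ k ∈ I, c (k, σ k)) ≠ ⊥

/-- Statement of stub 3 (`stub_windowCount`, M): window pigeonhole — served pairs in the window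
`[⌊n/2⌋+1-δ, ⌊n/2⌋]`, exact separation modulo `sat(ℤΛ)` with zero row sums, `m × m` matrix `g` ⇒
`C(n, ⌊n/2⌋+1-δ) ≤ m · 2^r`.  At `δ = 1` this is the tree's `stub_classCount` + Odlyzko.
[cite: LandsbergRessayre2017, §6] [cite: Odlyzko1981] -/
def Stmt.stub_windowCount : Prop :=
  ∀ (δ n m r : ℕ) (Λ : Fin r → (Fin n ⊕ Fin n) → ℤ) (d e : Fin n → ℂˣ) (γ₀ : ℂ) (g : Matrix (Fin m) (Fin m) ℂ),
    γ₀ ≠ 0 → (∀ i, (∑ k, Λ i (Sum.inl k)) = 0) →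
    (∀ χ : (Fin n ⊕ Fin n) → ℤ,
      (∏ k, (d k) ^ (χ (Sum.inl k))) * (∏ l, (e l) ^ (χ (Sum.inr l))) = 1 →
      ∃ (N : ℤ) (a : Fin r → ℤ), N ≠ 0 ∧ N • χ = ∑ i, a i • Λ i) →
    (∀ σ : Equiv.Perm (Fin n), ∃ I : Finset (Fin n), n / 2 + 1 - δ ≤ I.card ∧ I.card ≤ n / 2 ∧
      Module.End.maxGenEigenspace (Matrix.toLin' g) (γ₀ * ∏ k ∈ I, ((d k : ℂ) * (e (σ k) : ℂ))) ≠ ⊥) →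
    Nat.choose n (n / 2 + 1 - δ) ≤ m * 2 ^ r

/-! ## §2 The registered stubs -/

/-- Stub 1: graded lift package (monomial-wise intertwining, regularity, kernel-line eigenvalue).
[cite: LandsbergRessayre2017, §6] [cite: Vonzurgathen1987, Thm. 3.1] -/
theorem stub_gradedLift : Stmt.stub_gradedLift :=
  -- LANDED (p595633, val-lit-p7 g10); closed by name — wired 2026-08-28 by val-width-16133-w1 g2
  Summit.ValiantsHypothesis.ValiantsHypothesis.Theorems.FreeSubtorusOrbitDimensionBound.stub_gradedLift

/-- Stub 2: window weights (long-edge graded Leibniz / flow). [cite: LandsbergRessayre2017, Thm. 2.8, §6] -/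
theorem stub_windowWeights : Stmt.stub_windowWeights :=
  -- LANDED (p611098, val-width-16133-w1 g2; tools p610516); closed by name — wired 2026-08-28 by val-width-16133-w1 g2
  Summit.ValiantsHypothesis.ValiantsHypothesis.Theorems.FreeSubtorusOrbitDimensionBound.QuadraticCovering.stub_windowWeights

/-- Stub 3: window count (multi-level weighted pigeonhole + Odlyzko). [cite: LandsbergRessayre2017, §6] -/
theorem stub_windowCount : Stmt.stub_windowCount :=
  -- LANDED (p600260, val-lit-p4 g11); closed by name — wired 2026-08-28 by val-width-16133-w1 g2
  Summit.ValiantsHypothesis.ValiantsHypothesis.Theorems.FreeSubtorusOrbitDimensionBound.QuadraticCovering.stub_windowCount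

/-! ## §3 Composition (kernel-checked, no sorry below this line) -/

/-- **The whole dial from the three stubs**: `∀ δ, DegreeCovering δ`.  `δ = 0` is vacuous, `δ > ⌊n/2⌋` trivial; otherwise
generic element (tree, degree-free) → graded lift → window weights at `a = ⌊n/2⌋+1-δ` → window count.
[cite: LandsbergRessayre2017, Thm. 2.8, §6] [cite: Vonzurgathen1987, Thm. 3.1] -/
theorem degreeCovering_of (h₁ : Stmt.stub_gradedLift) (h₂ : Stmt.stub_windowWeights) (h₃ : Stmt.stub_windowCount)
    (δ : ℕ) : DegreeCovering δ := by
  rcases Nat.eq_zero_or_pos δ with h0 | hδ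
  · subst h0; exact degreeCovering_zero
  intro n hn m r Λ B hΛ hB
  by_cases hwin : δ ≤ n / 2
  swap
  · exact degreeCovering_of_lt n hn (by omega) m r Λ B hB
  classical
  -- (1) a generic element `(d, e)` of `T_Λ` (row half of admissibility; PROVED in the tree, degree-free)
  obtain ⟨d, e, hrel, hnocyc, hsep⟩ :=
    Summit.ValiantsHypothesis.ValiantsHypothesis.Theorems.FreeSubtorusConfusionCovering.stub_genericElement n r Λ
      (fun i => (hΛ i).1)
  -- (2) the graded lift package of its exact lift
  obtain ⟨g, h, γ₀, hγ₀, hmono, hker, hrank⟩ := h₁ δ n hn m r Λ B hB d e hrel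
  -- (3) window weights for the weights `c_{kl} = d_k e_l`
  have hc0 : ∀ p : Fin n × Fin n, ((fun p : Fin n × Fin n => (d p.1 : ℂ) * (e p.2 : ℂ)) p) ≠ 0 :=
    fun p => mul_ne_zero (d p.1).ne_zero (e p.2).ne_zero
  have hserved := h₂ δ n m B (fun p : Fin n × Fin n => (d p.1 : ℂ) * (e p.2 : ℂ)) g h γ₀ hδ hB.1.1 hB.1.2 hrank
    hc0 hnocyc hmono hker
  -- (4) the window `[⌊n/2⌋+1-δ, ⌊n/2⌋]` and the count
  refine h₃ δ n m r Λ d e γ₀ (g : Matrix (Fin m) (Fin m) ℂ) hγ₀ (fun i => (hΛ i).1) hsep fun σ => ?_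
  obtain ⟨I, hI1, hI2, hI3⟩ := hserved σ (n / 2 + 1 - δ) (by omega) (by omega)
  exact ⟨I, hI1, by omega, hI3⟩

/-- The top of the dial. -/
theorem AllDegreeCovering_of (h₁ : Stmt.stub_gradedLift) (h₂ : Stmt.stub_windowWeights)
    (h₃ : Stmt.stub_windowCount) : AllDegreeCovering :=
  degreeCovering_of h₁ h₂ h₃

/-- **The rung, numeric form (`δ = 2`), from the three stubs.** [cite: LandsbergRessayre2017, Question 2.2] -/
theorem QuadraticCovering_of (h₁ : Stmt.stub_gradedLift) (h₂ : Stmt.stub_windowWeights)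
    (h₃ : Stmt.stub_windowCount) : QuadraticCovering :=
  degreeCovering_of h₁ h₂ h₃ 2

/-- **The rung (filed declaration `QuadraticShadow`) from the three stubs.** [cite: LandsbergRessayre2017, Question 2.2] -/
theorem QuadraticShadow_of (h₁ : Stmt.stub_gradedLift) (h₂ : Stmt.stub_windowWeights)
    (h₃ : Stmt.stub_windowCount) : QuadraticShadow :=
  degreeShadow_of_degreeCovering (by norm_num) (QuadraticCovering_of h₁ h₂ h₃)

/-- Every notch of the shadow dial from the stubs. -/
theorem DegreeShadow_of (h₁ : Stmt.stub_gradedLift) (h₂ : Stmt.stub_windowWeights)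
    (h₃ : Stmt.stub_windowCount) (δ : ℕ) : DegreeShadow δ :=
  degreeShadow_of_degreeCovering' (degreeCovering_of h₁ h₂ h₃ δ)

/-- The rung, assembled from the registered stubs (sorries live only inside `stub_*`). [cite: LandsbergRessayre2017, Question 2.2] -/
theorem QuadraticShadow_proof : QuadraticShadow :=
  QuadraticShadow_of stub_gradedLift stub_windowWeights stub_windowCount

/-- The line re-proves the floor (rung family at `δ = 1` ⇒ floor, `Iff.rfl`). [cite: LandsbergRessayre2017, Thm. 2.8] -/
theorem floor_of_stubs (h₁ : Stmt.stub_gradedLift) (h₂ : Stmt.stub_windowWeights) (h₃ : Stmt.stub_windowCount) :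
    Summit.ValiantsHypothesis.ValiantsHypothesis.Theses.FreeSubtorus.SubtorusCovering :=
  degreeCovering_one_iff.mp (degreeCovering_of h₁ h₂ h₃ 1)

/-- … and the RELAXED closing of the host route: quadratic symmetrisation + the rung ⇒ the summit.
[cite: LandsbergRessayre2017, Question 2.2] -/
theorem summit_of_stubs (h₀ : OrbitQuadraticBound) (h₁ : Stmt.stub_gradedLift) (h₂ : Stmt.stub_windowWeights)
    (h₃ : Stmt.stub_windowCount) : _root_.ValiantsHypothesis :=
  closes_quadratic h₀ (QuadraticCovering_of h₁ h₂ h₃)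

end Summit.ValiantsHypothesis.ValiantsHypothesis.Cruxes.OrbitDimensionBound.Degree.Line

end
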